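import Summits.BirchSwinnertonDyer.BirchSwinnertonDyer.Theorems.GenusKolyvaginAtTwoEquivariantKolyvaginExactAtTwoLemma53Rat
import Summits.BirchSwinnertonDyer.Rank1Residual.X11b.TameCupLocalLemmas
import Literature.NumberTheory.EllipticCurves.WeilPairingTateDual
import Literature.NumberTheory.EllipticCurves.LocalKummerIsotropyTransport
import Literature.NumberTheory.EllipticCurves.KummerImageIsotropyProofs
import Literature.NumberTheory.EllipticCurves.KummerSelmerStructure
import Literature.NumberTheory.GaloisCohomology.PoitouTateNumberField
import HarnessLib

/-!
# Route `GenusKolyvaginAtTwo`, LINE 6, KEY crux Q3 `EquivariantKolyvaginExactAtTwo`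
# (stmt-BirchSwinnertonDyer-24882): Poitou–Tate over `ℚ` kills the local cup product at a
# Kolyvagin prime, and the `duality` field over `ℚ_ℓ` at `2` MODULO ONE LOCAL SHAPE (Gross (7.6)
# for a regular Frobenius action)

Helper (seat `bsd-line-gk2-p3` g11; `--supports` the item, closes nothing). Sequel to
`…Lemma53Rat` (`lemma_5_3_descent_of_reciprocity_rat_two`: McCallum's Lemma 5.3 over `ℚ_ℓ` at `2` from the
reciprocity value (R)_ℚ). The tree's road to (R) over `K` (cell `b2b-bsdres`, x11b3; `GrossProp82OfPoitouTate`)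
is: Poitou–Tate (`poitouTate_sum_localTatePairing_eq_zero_holds`, PROVED for every number field) + isotropy of the
Kummer conditions off `λ` ⟹ the LOCAL cup product of `s_λ`, `d_λ` vanishes; then Gross (7.6) in qualitative
form (`X11b.TameCup.weilPairing_apply_eq_one_of_cupProduct_eq_zero`) turns that into `e([s, F], [d, σ]) = 1` —
but that local theorem ASSUMES `Γ_{K_λ}` acts TRIVIALLY on `E[n]`, which is the `K_λ`-situation
(`Frob_λ = Frob_ℓ²`). Over `ℚ_ℓ` at a Kolyvagin prime `Γ_{ℚ_ℓ}` acts on `E[2^M]` through the REGULAR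
involution `Frob_ℓ ∼ c₀`, and restricting to `K_λ` loses exactly one bit (`inv_λ ∘ res = 2·inv_ℓ`), so the
`ℚ_ℓ`-shape is genuinely new local content.

* §1 `cupProduct_localization_eq_zero_of_selmer_rat` — **the global half over `ℚ`, PROVED**: for `E = W/ℚ`,
  any `n ≥ 2`, a finite place `v`, `s ∈ Sel^{(n)}(E/ℚ)` and `d ∈ H¹(ℚ, E[n])` Selmer at every finite place
  `≠ v` and at `∞`: the cup product (Weil pairing) of the localisations of `s` and `d` at `v` VANISHES in
  `H²(ℚ_v, μₙ)` (x11b3's argument verbatim over `ℚ`: every other local term is a pairing of two Kummer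
  classes, `kummerClass_cupProduct_kummerClass_eq_zero_holds`; Poitou–Tate; `inv_v` injective).
* §2 `lemma_5_3_rat_two_of_tameShape` — **the `duality` field of the split descent over `ℚ_ℓ` at `2`
  MODULO the regular tame shape**: the hypothesis `hShape` is Gross (7.6) over `ℚ_ℓ` for a Frobenius acting
  as a complex conjugation, in GLOBAL coordinates — *"if the local cup product of `s_v`, `d_v` vanishes and
  `s` is Selmer at `v`, then `e([s, F], [d, σ]) = 1` for every Frobenius `F` at a prime `𝔓 ∣ v` acting on
  `E[q]` as a complex conjugation and every `σ ∈ I_𝔓`"* — displayed, NOT proved here; everything else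
  (Weil pairing, §1, `…Lemma53Rat`) is proved. This isolates the ONE local statement the `p = 2`
  descent over `ℚ` needs beyond the tree.

THEOREMS ONLY (no definition, no named fact, no `sorry`, standard axioms). BSD is not proved by any of this.

References: [GrossLMS1991] §7 (7.1)–(7.6), Prop. 8.2; [McCallumLMS1991] §2 Prop. 2.2, §5 Lemma 5.3;
[MilneADT2006] I Thm. 4.10(b), Cor. 2.3; [CasselsFrohlichANT1967] VII §11.
-/

set_option autoImplicit false
set_option linter.dupNamespace false -- tree convention: `Summit.BirchSwinnertonDyer.BirchSwinnertonDyer.Theorems` (summit = sub-problem)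

noncomputable section

open scoped Classical Pointwise

universe u

namespace Summit.BirchSwinnertonDyer.BirchSwinnertonDyer.Theorems.GenusExact.FrobeniusCriterion

open WeierstrassCurve NumberField IsDedekindDomain Field
open Literature.NumberTheory.EllipticCurves Literature.NumberTheory.GaloisRepresentations
open Literature.NumberTheory.GaloisCohomology
open Literature.NumberTheory.GaloisRepresentations.DiscreteGaloisModule (mu MuCarrier)
open Summit.BirchSwinnertonDyer.Rank1Residual.X11b

/-! ## §1 Poitou–Tate over a number field: the local cup product at `v` of a Selmer class and a class Selmer off `v` vanishes -/

section Global

variable {K : Type u} [Field K] [NumberField K] (W : WeierstrassCurve K) [W.IsElliptic]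

/-- **The local cup product at `v` vanishes** (McCallum's Prop. 2.2 / Gross's proof of Prop. 8.2, global
half): for `E = W/K` elliptic, `n ≥ 2` invertible... (any `n ≥ 2`), a Weil pairing `e` on `E[n]`, a family
of local invariant maps as in the Poitou–Tate fact, a finite place `v`, `s ∈ Sel^{(n)}(E/K)` and `d ∈ H¹(K, E[n])`
satisfying the Selmer condition at every finite place `≠ v` and at every infinite place: the cup product of
the localisations `s_v`, `d_v` on `Γ_{K_v}` is `0` in `H²(K_v, μₙ)`. Every local term off `v` pairs two Kummer
classes (isotropy, `kummerClass_cupProduct_kummerClass_eq_zero_holds`), the Poitou–Tate sum over `S = {v}`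
vanishes, and `inv_v` is injective. [cite: McCallumLMS1991, §2 Prop. 2.2] [cite: GrossLMS1991, Prop. 8.2 (proof)]
[cite: MilneADT2006, Ch. I Thm. 4.10(b)] -/
theorem cupProduct_localization_eq_zero_of_selmer (hPT : poitouTate_sum_localTatePairing_eq_zero K)
    {n : ℕ} [NeZero n] (e : geomTorsion W n → geomTorsion W n → AlgebraicClosure K)
    (hμ : ∀ S T, e S T ^ n = 1) (hadd₁ : ∀ S₁ S₂ T, e (S₁ + S₂) T = e S₁ T * e S₂ T)
    (hadd₂ : ∀ S T₁ T₂, e S (T₁ + T₂) = e S T₁ * e S T₂) (halt : ∀ T, e T T = 1)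
    (hgal : ∀ (σ : absoluteGaloisGroup K) (S T : geomTorsion W n), σ • e S T = e (σ • S) (σ • T))
    (v : HeightOneSpectrum (𝓞 K)) {s : galH1Torsion W (n : ℤ)} (hs : s ∈ selmerGroup W (n : ℤ))
    {d : galH1Torsion W (n : ℤ)}
    (hdfin : ∀ w : HeightOneSpectrum (𝓞 K), w ≠ v → d ∈ selmerLocalKer W (w.adicCompletion K) (n : ℤ))
    (hdinf : ∀ w : InfinitePlace K, d ∈ selmerLocalKer W w.Completion (n : ℤ)) :
    haveI := absoluteGaloisGroup_compactSpace (v.adicCompletion K)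
    ((weilContPairing W n e hμ hadd₁ hadd₂ hgal).restrict
      (absGaloisRestrict K (v.adicCompletion K))).cupProduct
        (galoisCohomology.localization (W.torsionGaloisModule ((n : ℕ) : ℤ)) (Sum.inr v) 1 s)
        (galoisCohomology.localization (W.torsionGaloisModule ((n : ℕ) : ℤ)) (Sum.inr v) 1 d) = 0 := by
  have _hΓc : ∀ (L : Type u) [Field L], CompactSpace (absoluteGaloisGroup L) :=
    fun L _ => absoluteGaloisGroup_compactSpace L
  -- the family of local invariant maps of the Poitou–Tate fact at level `n`
  obtain ⟨inv, hperf, hsum⟩ := hPT n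
  -- the finite set of places `S = {v}`
  set S : Finset (Place K) := {Sum.inr v} with hSdef
  have hmemS : Sum.inr v ∈ S := Finset.mem_singleton_self _
  -- local terms vanish off `S`: both classes satisfy the Kummer condition there (isotropy)
  have hsS : s ∈ (W.kummerSelmerStructure ((n : ℕ) : ℤ)).selmerGroup := by
    rw [← selmerGroup_eq_selmerGroup_kummerSelmerStructure]; exact hs
  have hloc_s : ∀ w : Place K, galoisCohomology.localization (W.torsionGaloisModule ((n : ℕ) : ℤ)) w 1 s ∈
      W.kummerSelmerStructure ((n : ℕ) : ℤ) w :=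
    (((W.kummerSelmerStructure ((n : ℕ) : ℤ)).mem_selmerGroup_iff s).mp hsS)
  have hloc_d : ∀ w : Place K, w ∉ S →
      galoisCohomology.localization (W.torsionGaloisModule ((n : ℕ) : ℤ)) w 1 d ∈
        W.kummerSelmerStructure ((n : ℕ) : ℤ) w := by
    intro w hw
    have hmem : d ∈ selmerLocalKer W (Place.Completion w) ((n : ℕ) : ℤ) := by
      rcases w with w | w
      · exact hdinf w
      · refine hdfin w (fun h => hw ?_)
        rw [h]
        exact hmemS
    rw [← W.comap_localization_kummerSelmerStructure ((n : ℕ) : ℤ) w] at hmem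
    exact hmem
  have hS : ∀ w ∉ S,
      inv w ((weilContPairingLocal W n e hμ hadd₁ hadd₂ hgal w).cupProduct
        (galoisCohomology.localization (W.torsionGaloisModule ((n : ℕ) : ℤ)) w 1 s)
        (galoisCohomology.localization (W.torsionGaloisModule ((n : ℕ) : ℤ)) w 1 d)) = 0 := by
    intro w hw
    have h0 := W.cupProduct_eq_zero_of_mem_kummerSelmerStructure_of_fact n e
      (by exact_mod_cast NeZero.ne n) w (kummerClass_cupProduct_kummerClass_eq_zero_holds (Place.Completion w))
      hμ hadd₁ hadd₂ halt hgal (hloc_s w) (hloc_d w hw)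
    exact (congrArg (inv w) h0).trans (map_zero _)
  -- Poitou–Tate: the local term at `v` vanishes too, hence the local cup product is zero
  have hPTsum := sum_inv_weilCupProduct_localization_eq_zero W n e hμ hadd₁ hadd₂ hgal inv hsum s d S hS
  rw [Finset.sum_singleton] at hPTsum
  exact (hperf v).1.injective (hPTsum.trans (map_zero _).symm)

end Global

/-! ## §2 The `duality` field over `ℚ_ℓ` at `2`, modulo the regular tame shape -/

section Duality

variable (W : WeierstrassCurve ℚ) [W.IsElliptic]

/-- **McCallum's Lemma 5.3 with Prop. 2.2 over `ℚ_ℓ` at `p = 2`, MODULO Gross (7.6) for a regular Frobenius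
action.** Setting of `lemma_5_3_descent_of_reciprocity_rat_two` (`Δ(E) < 0`, `q = 2^M`, `ℓ` odd good at `v`,
`Frob(ℓ) = Frob(∞)` on `ℚ(E[q])`), with `s ∈ Sel^{(q)}(E/ℚ)` and `d ∈ H¹(ℚ, E[q])` Selmer at the finite places
`≠ v` and at `∞` but `2^a d` NOT Selmer at `v`. HYPOTHESIS `hShape` (displayed, not proved — the ONE local
statement beyond the tree): for the Weil pairing `e` on `E[q]`, *if the local cup product of `s_v`, `d_v`
vanishes then `e([s, F], [d, σ]) = 1` for every prime `𝔓 ∣ v`, every arithmetic Frobenius `F` at `𝔓` acting on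
`E[q]` as a complex conjugation and every `σ ∈ I_𝔓`* (Gross (7.6) in qualitative form at a local field whose
Galois group acts on `E[q]` through a regular involution; the tree's
`X11b.TameCup.weilPairing_apply_eq_one_of_cupProduct_eq_zero` is the trivial-action case). CONCLUSION:
**`2^{M−1−a}·s_v = 0`**. Proof: Weil pairing (`exists_weilPairing_holds`), §1 with Poitou–Tate over `ℚ`
(PROVED, `poitouTate_sum_localTatePairing_eq_zero_holds`), `hShape`, and `lemma_5_3_descent_of_reciprocity_rat_two`.
[cite: McCallumLMS1991, §5 Lemma 5.3, §2 Prop. 2.2] [cite: GrossLMS1991, §7 (7.6), Prop. 8.2] -/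
theorem lemma_5_3_rat_two_of_tameShape (hΔ : W.Δ < 0) {M : ℕ} (hM : 1 ≤ M) {q : ℕ} (hq : q = 2 ^ M)
    [NeZero q] {ℓ : ℕ} (hℓ : ℓ.Prime) (hℓ2 : ℓ ≠ 2) {v : HeightOneSpectrum (𝓞 ℚ)}
    (hℓv : (ℓ : 𝓞 ℚ) ∈ v.asIdeal) (hgood : W.HasGoodReductionAt v) {K : Type} [Field K] [NumberField K]
    (hℓM : FrobEqFrobInfty W K q ℓ)
    (hShape : ∀ (e : geomTorsion W q → geomTorsion W q → AlgebraicClosure ℚ)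
      (hμ : ∀ S T, e S T ^ q = 1) (hadd₁ : ∀ S₁ S₂ T, e (S₁ + S₂) T = e S₁ T * e S₂ T)
      (hadd₂ : ∀ S T₁ T₂, e S (T₁ + T₂) = e S T₁ * e S T₂)
      (hgal : ∀ (σ : absoluteGaloisGroup ℚ) (S T : geomTorsion W q), σ • e S T = e (σ • S) (σ • T)),
      (∀ T, e T T = 1) → (∀ T, (∀ S, e S T = 1) → T = 0) →
      ∀ (s d : galH1Torsion W (q : ℤ)), s ∈ selmerLocalKer W (v.adicCompletion ℚ) (q : ℤ) →
      (haveI := absoluteGaloisGroup_compactSpace (v.adicCompletion ℚ)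
       ((weilContPairing W q e hμ hadd₁ hadd₂ hgal).restrict
          (absGaloisRestrict ℚ (v.adicCompletion ℚ))).cupProduct
          (galoisCohomology.localization (W.torsionGaloisModule ((q : ℕ) : ℤ)) (Sum.inr v) 1 s)
          (galoisCohomology.localization (W.torsionGaloisModule ((q : ℕ) : ℤ)) (Sum.inr v) 1 d) = 0) →
      ∀ 𝔓 ∈ v.primesAbove, ∀ F c₀ : absoluteGaloisGroup ℚ, IsArithFrobAt (𝓞 ℚ) F 𝔓 →
        IsComplexConjugation (Rat.castHom ℝ) c₀ → (∀ P : geomTorsion W (q : ℤ), F • P = c₀ • P) →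
        ∀ σ ∈ 𝔓.inertia (absoluteGaloisGroup ℚ), e (h1Eval W (q : ℤ) s F) (h1Eval W (q : ℤ) d σ) = 1)
    {s : galH1Torsion W (q : ℤ)} (hs : s ∈ selmerGroup W (q : ℤ))
    {d : galH1Torsion W (q : ℤ)}
    (hdfin : ∀ w : HeightOneSpectrum (𝓞 ℚ), w ≠ v → d ∈ selmerLocalKer W (w.adicCompletion ℚ) (q : ℤ))
    (hdinf : ∀ w : InfinitePlace ℚ, d ∈ selmerLocalKer W w.Completion (q : ℤ))
    {a : ℕ} (hdv : ((2 : ℤ) ^ a) • d ∉ selmerLocalKer W (v.adicCompletion ℚ) (q : ℤ)) :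
    ((2 : ℤ) ^ (M - 1 - a)) • s ∈ W.torsionLocalKer (v.adicCompletion ℚ) (q : ℤ) := by
  have hq2 : 2 ≤ q := by
    rw [hq]
    calc 2 = 2 ^ 1 := (pow_one 2).symm
      _ ≤ 2 ^ M := Nat.pow_le_pow_right (by norm_num) hM
  have hq0 : q ≠ 0 := by omega
  have hqQ : ((q : ℕ) : ℚ) ≠ 0 := Nat.cast_ne_zero.mpr hq0
  -- the Weil pairing on `E[q]`
  obtain ⟨e, hμ, hadd₁, hadd₂, halt, hnondeg, hgal⟩ := W.exists_weilPairing_holds q hq2 hqQ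
  -- the local Selmer condition of `s` at `v`
  have hsv : s ∈ selmerLocalKer W (v.adicCompletion ℚ) (q : ℤ) := ((mem_selmerGroup_iff W _ s).mp hs).1 v
  -- §1: the local cup product at `v` vanishes (Poitou–Tate over `ℚ`, PROVED)
  have hcup := cupProduct_localization_eq_zero_of_selmer W (poitouTate_sum_localTatePairing_eq_zero_holds ℚ)
    e hμ hadd₁ hadd₂ halt hgal v hs hdfin hdinf
  -- the reciprocity value in additive form, via the displayed local shape
  have hR : ∀ 𝔓 ∈ v.primesAbove, ∀ F c₀ : absoluteGaloisGroup ℚ, IsArithFrobAt (𝓞 ℚ) F 𝔓 →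
      IsComplexConjugation (Rat.castHom ℝ) c₀ → (∀ P : geomTorsion W (q : ℤ), F • P = c₀ • P) →
      ∀ σ ∈ 𝔓.inertia (absoluteGaloisGroup ℚ),
        weilPairingHom W q e hμ hadd₁ hadd₂ (h1Eval W (q : ℤ) s F) (h1Eval W (q : ℤ) d σ) = 0 := by
    intro 𝔓 h𝔓 F c₀ hF hc₀ hE σ hσ
    rw [TameCup.weilPairingHom_eq_zero_iff]
    exact hShape e hμ hadd₁ hadd₂ hgal halt hnondeg s d hsv hcup 𝔓 h𝔓 F c₀ hF hc₀ hE σ hσ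
  exact lemma_5_3_descent_of_reciprocity_rat_two W hΔ hM hq hℓ hℓ2 hℓv hgood hℓM
    (weilPairingHom W q e hμ hadd₁ hadd₂) (weilPairingHom_self W q e hμ hadd₁ hadd₂ halt)
    (TameCup.weilPairingHom_left_nondeg W q e hμ hadd₁ hadd₂ halt hnondeg) hdv hsv hR

end Duality

end Summit.BirchSwinnertonDyer.BirchSwinnertonDyer.Theorems.GenusExact.FrobeniusCriterion

end
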